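import Literature.NumberTheory.LFunctions.SmoothedExplicitFormulaShift
import Mathlib.Analysis.SpecialFunctions.ImproperIntegrals
import Mathlib.MeasureTheory.Measure.Lebesgue.Integral
import HarnessLib

/-!
# A crude explicit bound for Kadiri's `U₀`-integral `J(a, t) = ∫ |Re ψ((1/2+iy)/2)| dy/(a² + (t−y)²)` (Acta Arith. 117 (2005), Lemma 3.6, (C40)–(C41))

Topic `Literature/NumberTheory/LFunctions`. Everything in this file is PROVED (no named fact, no
definition). The `Γ`-remainder `T₂` of Kadiri's explicit formula is bounded
(`KadiriExplicit.abs_kadiriT2_le`) in terms of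

  `J(a, t) = ∫_ℝ |Re Γ'/Γ(1/4 + iy/2)| /(a² + (t − y)²) dy`,

Kadiri's `∫ U₀(T) dT/(x² + (T−y)²)` ((C40); Mossinghoff–Trudgian 2015 §4.4 evaluate it by
splitting at `t* ≈ 2.2` and `b(1 ± ε)`). For the tree's discharge of the Mossinghoff–Trudgian–Yang
constant only the SHAPE `J(a, t) ≤ (π/a) log t + O(1)` matters (the coefficient `π/a` being the
sharp one), and we prove the crude explicit version

  `J(a, t) ≤ (π/a)(log(3 + |t|) + 12) + 4/a² + 8`   (`a > 0`),

from `|Re ψ((1/2+iy)/2)| ≤ log(3+|y|) + 12` (`KadiriGamma.abs_re_digamma_le`),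
`log(3+|y|) ≤ log(3+|t|) + log(1+|y−t|)`, `log(1+z) ≤ 2√z`, `∫ du/(a²+u²) = π/a` and
`∫ √|u| du/(a²+u²) ≤ 2/a² + 4`. Corollaries: `J(a, 0) ≤ (π/a)(log 3 + 12) + 4/a² + 8` and, for
`t ≥ 3`, `J(a, t) ≤ (π/a) log t + (π/a)(12 + log 2) + 4/a² + 8`.

## References

* H. Kadiri, Acta Arith. 117 (2005) = arXiv:math/0401238, Lemma 3.6, Lemma 4.7, (C40), (C41).
  (`Kadiri2005`)
* M. J. Mossinghoff, T. S. Trudgian, J. Number Theory 157 (2015) = arXiv:1410.3926, §4.4.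
  (`MossinghoffTrudgian2015`)
-/

noncomputable section

open Real MeasureTheory Set Filter

namespace Literature.NumberTheory.LFunctions

namespace KadiriDigammaIntegral

/-! ## Elementary pieces -/

/-- `log(1 + z) ≤ 2√z` for `z ≥ 0` (`log x ≤ 2(√x − 1)` and `√(1+z) ≤ 1 + √z`). [folklore] -/
theorem log_one_add_le_two_sqrt {z : ℝ} (hz : 0 ≤ z) : Real.log (1 + z) ≤ 2 * Real.sqrt z := by
  have h1 : Real.log (1 + z) = 2 * Real.log (Real.sqrt (1 + z)) := by
    rw [Real.log_sqrt (by linarith)]; ring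
  have h2 : Real.log (Real.sqrt (1 + z)) ≤ Real.sqrt (1 + z) - 1 :=
    Real.log_le_sub_one_of_pos (Real.sqrt_pos.2 (by linarith))
  have h3 : Real.sqrt (1 + z) ≤ 1 + Real.sqrt z := by
    rw [Real.sqrt_le_left (by positivity)]
    nlinarith [Real.sq_sqrt hz, Real.sqrt_nonneg z]
  linarith

/-- `∫_ℝ du/(a² + u²) = π/a` (`a > 0`). [folklore] -/
theorem integral_inv_sq_add_sq {a : ℝ} (ha : 0 < a) : ∫ u : ℝ, 1 / (a ^ 2 + u ^ 2) = π / a := by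
  have h := Measure.integral_comp_mul_left (fun u : ℝ ↦ 1 / (a ^ 2 + u ^ 2)) a
  have ha' : a ≠ 0 := ha.ne'
  have e : ∀ x : ℝ, 1 / (a ^ 2 + (a * x) ^ 2) = (a ^ 2)⁻¹ * (1 + x ^ 2)⁻¹ := fun x ↦ by
    field_simp
  have h2 : ∫ x : ℝ, 1 / (a ^ 2 + (a * x) ^ 2) = (a ^ 2)⁻¹ * π := by
    simp_rw [e, integral_const_mul, integral_univ_inv_one_add_sq]
  rw [h2, abs_of_pos (inv_pos.2 ha), smul_eq_mul] at h
  -- `h : (a²)⁻¹ π = a⁻¹ · ∫ 1/(a²+y²)`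
  calc ∫ y : ℝ, 1 / (a ^ 2 + y ^ 2) = a * (a⁻¹ * ∫ y : ℝ, 1 / (a ^ 2 + y ^ 2)) := by field_simp
    _ = a * ((a ^ 2)⁻¹ * π) := by rw [← h]
    _ = π / a := by field_simp

/-- `u ↦ 1/(a² + u²)` is integrable (`a > 0`). [folklore] -/
theorem integrable_inv_sq_add_sq {a : ℝ} (ha : 0 < a) : Integrable fun u : ℝ ↦ 1 / (a ^ 2 + u ^ 2) := by
  have h := (integrable_inv_one_add_sq.comp_mul_left' (inv_ne_zero ha.ne')).const_mul (a ^ 2)⁻¹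
  refine h.congr (ae_of_all _ fun u ↦ ?_)
  have ha' : a ≠ 0 := ha.ne'
  field_simp

/-- The majorant `g(x) = 1/a²` on `(0, 1]`, `x^{−3/2}` on `(1, ∞)`, of `√x/(a²+x²)` (`0 < a ≤ 1`),
and `∫_{(0,∞)} g = 1/a² + 2`. [folklore] -/
theorem integral_Ioi_majorant (a : ℝ) :
    (∫ x in Ioi (0 : ℝ), (fun x : ℝ ↦ if x ≤ 1 then 1 / a ^ 2 else x ^ (-(3 / 2 : ℝ))) x) = 1 / a ^ 2 + 2 ∧
      IntegrableOn (fun x : ℝ ↦ if x ≤ 1 then 1 / a ^ 2 else x ^ (-(3 / 2 : ℝ))) (Ioi 0) := by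
  set g : ℝ → ℝ := fun x ↦ if x ≤ 1 then 1 / a ^ 2 else x ^ (-(3 / 2 : ℝ)) with hg
  have hsplit : Ioi (0 : ℝ) = Ioc 0 1 ∪ Ioi 1 := (Ioc_union_Ioi_eq_Ioi zero_le_one).symm
  have hdisj : Disjoint (Ioc (0 : ℝ) 1) (Ioi 1) := by
    rw [Set.disjoint_left]; intro x hx hx'; exact absurd hx.2 (not_le.2 hx')
  have hg1 : EqOn g (fun _ ↦ 1 / a ^ 2) (Ioc 0 1) := fun x hx ↦ by simp [hg, hx.2]
  have hg2 : EqOn g (fun x ↦ x ^ (-(3 / 2 : ℝ))) (Ioi 1) := fun x hx ↦ by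
    simp [hg, not_le.2 (mem_Ioi.1 hx)]
  have hint1 : IntegrableOn g (Ioc 0 1) :=
    (integrableOn_const (by simp)).congr_fun hg1.symm measurableSet_Ioc
  have hint2 : IntegrableOn g (Ioi 1) :=
    (integrableOn_Ioi_rpow_of_lt (by norm_num) one_pos).congr_fun hg2.symm measurableSet_Ioi
  refine ⟨?_, by rw [hsplit]; exact hint1.union hint2⟩
  rw [hsplit, setIntegral_union hdisj measurableSet_Ioi hint1 hint2,
    setIntegral_congr_fun measurableSet_Ioc hg1, setIntegral_congr_fun measurableSet_Ioi hg2,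
    setIntegral_const, integral_Ioi_rpow_of_lt (by norm_num) one_pos]
  simp
  norm_num

/-- **`∫ √|u| du/(a² + u²) ≤ 2/a² + 4`** (`0 < a ≤ 1`), and integrability. [folklore] -/
theorem integral_sqrt_abs_div_le {a : ℝ} (ha : 0 < a) :
    Integrable (fun u : ℝ ↦ Real.sqrt |u| / (a ^ 2 + u ^ 2)) ∧
      ∫ u : ℝ, Real.sqrt |u| / (a ^ 2 + u ^ 2) ≤ 2 / a ^ 2 + 4 := by
  set g : ℝ → ℝ := fun x ↦ if x ≤ 1 then 1 / a ^ 2 else x ^ (-(3 / 2 : ℝ)) with hg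
  obtain ⟨hgint, hgon⟩ := integral_Ioi_majorant a
  -- pointwise domination `√|u|/(a²+u²) ≤ g |u|`
  have hdom : ∀ u : ℝ, Real.sqrt |u| / (a ^ 2 + u ^ 2) ≤ g |u| := by
    intro u
    set x := |u| with hx
    have hx0 : 0 ≤ x := abs_nonneg u
    have hu2 : u ^ 2 = x ^ 2 := (sq_abs u).symm
    rw [hu2]
    simp only [hg]
    split_ifs with h1
    · have hs : Real.sqrt x ≤ 1 := Real.sqrt_le_one.mpr h1
      rw [div_le_div_iff₀ (by positivity) (by positivity)]
      nlinarith [Real.sqrt_nonneg x, sq_nonneg x]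
    · push Not at h1
      have hx1 : 1 < x := h1
      have hxpos : 0 < x := by linarith
      have e : x ^ (-(3 / 2 : ℝ)) = Real.sqrt x / x ^ 2 := by
        rw [Real.sqrt_eq_rpow, show (-(3 / 2 : ℝ)) = 1 / 2 - 2 by norm_num,
          Real.rpow_sub hxpos, Real.rpow_two]
      rw [e]
      exact div_le_div_of_nonneg_left (Real.sqrt_nonneg _) (by positivity) (by nlinarith)
  -- the even majorant `u ↦ g |u|` is integrable with integral `2(1/a² + 2)`
  have hgabs_int : Integrable fun u : ℝ ↦ g |u| := by
    have h1 : IntegrableOn (fun u : ℝ ↦ g |u|) (Ioi 0) :=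
      hgon.congr_fun (fun u hu ↦ by rw [abs_of_pos (mem_Ioi.1 hu)]) measurableSet_Ioi
    have h2 : IntegrableOn (fun u : ℝ ↦ g |u|) (Iic 0) := by
      have := h1.comp_neg  -- integrable on `-Ioi 0`
      have hset : -Ioi (0 : ℝ) = Iio 0 := by ext x; simp
      have h3 : IntegrableOn (fun u : ℝ ↦ g |u|) (Iio 0) := by
        have h4 : IntegrableOn (fun u : ℝ ↦ g |-u|) (Iio 0) := by
          simpa [hset] using this
        exact h4.congr_fun (fun u _ ↦ by simp only [abs_neg]) measurableSet_Iio
      exact h3.congr_set_ae Iio_ae_eq_Iic.symm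
    have := h2.union h1
    rwa [Iic_union_Ioi, integrableOn_univ] at this
  have hcont : Continuous fun u : ℝ ↦ Real.sqrt |u| / (a ^ 2 + u ^ 2) :=
    Continuous.div (Real.continuous_sqrt.comp continuous_abs) (by fun_prop) fun u ↦ by positivity
  have hint : Integrable fun u : ℝ ↦ Real.sqrt |u| / (a ^ 2 + u ^ 2) :=
    hgabs_int.mono' hcont.aestronglyMeasurable (ae_of_all _ fun u ↦ by
      rw [Real.norm_eq_abs, abs_of_nonneg (by positivity)]; exact hdom u)
  refine ⟨hint, ?_⟩
  calc ∫ u : ℝ, Real.sqrt |u| / (a ^ 2 + u ^ 2) ≤ ∫ u : ℝ, g |u| := integral_mono hint hgabs_int hdom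
    _ = 2 * ∫ x in Ioi (0 : ℝ), g x := integral_comp_abs
    _ = 2 / a ^ 2 + 4 := by rw [hgint]; ring

/-! ## The bound for `J(a, t)` -/

/-- **Crude explicit bound for Kadiri's `U₀`-integral**: for `a > 0` and real `t`,
`∫ |Re ψ((1/2+iy)/2)| dy/(a² + (t−y)²) ≤ (π/a)(log(3+|t|) + 12) + 4/a² + 8`.
[cite: Kadiri2005, Lemma 4.7 (C40)] -/
theorem J_le {a : ℝ} (ha : 0 < a) (t : ℝ) :
    (∫ y : ℝ, |(Complex.digamma (((((1 / 2 : ℝ)) : ℂ) + y * Complex.I) / 2)).re| /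
        (a ^ 2 + (t - y) ^ 2)) ≤
      π / a * (Real.log (3 + |t|) + 12) + (4 / a ^ 2 + 8) := by
  set L : ℝ := Real.log (3 + |t|) + 12 with hL
  have hL0 : 0 ≤ L := by
    have := Real.log_nonneg (by linarith [abs_nonneg t] : (1 : ℝ) ≤ 3 + |t|); rw [hL]; linarith
  obtain ⟨hsint, hsle⟩ := integral_sqrt_abs_div_le ha
  -- the majorant after translation `u = y − t`
  set F : ℝ → ℝ := fun u ↦ L * (1 / (a ^ 2 + u ^ 2)) + 2 * (Real.sqrt |u| / (a ^ 2 + u ^ 2)) with hF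
  have hFint : Integrable F := ((integrable_inv_sq_add_sq ha).const_mul L).add (hsint.const_mul 2)
  have hFval : ∫ u, F u ≤ π / a * L + (4 / a ^ 2 + 8) := by
    calc ∫ u, F u = L * (π / a) + 2 * ∫ u : ℝ, Real.sqrt |u| / (a ^ 2 + u ^ 2) := by
          rw [hF, integral_add ((integrable_inv_sq_add_sq ha).const_mul L) (hsint.const_mul 2),
            integral_const_mul, integral_const_mul, integral_inv_sq_add_sq ha]
      _ ≤ L * (π / a) + 2 * (2 / a ^ 2 + 4) := by gcongr
      _ = π / a * L + (4 / a ^ 2 + 8) := by ring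
  -- pointwise bound for the integrand, in the variable `y`
  have hpt : ∀ y : ℝ, |(Complex.digamma (((((1 / 2 : ℝ)) : ℂ) + y * Complex.I) / 2)).re| /
      (a ^ 2 + (t - y) ^ 2) ≤ F (y - t) := by
    intro y
    have h1 := KadiriGamma.abs_re_digamma_le y
    have hq : 0 < a ^ 2 + (t - y) ^ 2 := by positivity
    have e : (t - y) ^ 2 = (y - t) ^ 2 := by ring
    -- `log(3 + |y|) ≤ log(3 + |t|) + log(1 + |y − t|) ≤ log(3+|t|) + √|y−t|`
    have h2 : Real.log (3 + |y|) ≤ Real.log (3 + |t|) + 2 * Real.sqrt |y - t| := by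
      have h3 : 3 + |y| ≤ (3 + |t|) * (1 + |y - t|) := by
        have := abs_add_le t (y - t)
        rw [add_sub_cancel] at this
        nlinarith [abs_nonneg t, abs_nonneg (y - t)]
      calc Real.log (3 + |y|) ≤ Real.log ((3 + |t|) * (1 + |y - t|)) :=
            Real.log_le_log (by positivity) h3
        _ = Real.log (3 + |t|) + Real.log (1 + |y - t|) :=
            Real.log_mul (by positivity) (by positivity)
        _ ≤ Real.log (3 + |t|) + 2 * Real.sqrt |y - t| := by
            linarith [log_one_add_le_two_sqrt (abs_nonneg (y - t))]
    have hq' : 0 < a ^ 2 + (y - t) ^ 2 := by positivity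
    simp only [hF, e]
    calc |(Complex.digamma (((((1 / 2 : ℝ)) : ℂ) + y * Complex.I) / 2)).re| / (a ^ 2 + (y - t) ^ 2)
        ≤ (L + 2 * Real.sqrt |y - t|) / (a ^ 2 + (y - t) ^ 2) :=
          div_le_div_of_nonneg_right (by rw [hL]; linarith) hq'.le
      _ = L * (1 / (a ^ 2 + (y - t) ^ 2)) + 2 * (Real.sqrt |y - t| / (a ^ 2 + (y - t) ^ 2)) := by ring
  -- integrate
  have hFt : Integrable fun y : ℝ ↦ F (y - t) := hFint.comp_sub_right t
  have hcont : Continuous fun y : ℝ ↦ |(Complex.digamma (((((1 / 2 : ℝ)) : ℂ) + y * Complex.I) / 2)).re| /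
      (a ^ 2 + (t - y) ^ 2) := by
    refine Continuous.div ?_ (by fun_prop) fun y ↦ by positivity
    refine continuous_abs.comp ?_
    exact (Complex.continuous_re.comp SmoothedEF.continuous_re_digamma_half_line).congr
      fun y ↦ by simp [Function.comp]
  have hint : Integrable fun y : ℝ ↦ |(Complex.digamma (((((1 / 2 : ℝ)) : ℂ) + y * Complex.I) / 2)).re| /
      (a ^ 2 + (t - y) ^ 2) :=
    hFt.mono' hcont.aestronglyMeasurable (ae_of_all _ fun y ↦ by
      rw [Real.norm_eq_abs, abs_of_nonneg (by positivity)]; exact hpt y)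
  calc (∫ y : ℝ, |(Complex.digamma (((((1 / 2 : ℝ)) : ℂ) + y * Complex.I) / 2)).re| /
        (a ^ 2 + (t - y) ^ 2)) ≤ ∫ y : ℝ, F (y - t) := integral_mono hint hFt hpt
    _ = ∫ u : ℝ, F u := integral_sub_right_eq_self F t
    _ ≤ π / a * L + (4 / a ^ 2 + 8) := hFval

/-- **At `t = 0`**: `J(a, 0) ≤ (π/a)(log 3 + 12) + 4/a² + 8` (the hypothesis `hJ0` of
`KadiriExplicit.master_explicit`). [cite: Kadiri2005, (C41)] -/
theorem J_zero_le {a : ℝ} (ha : 0 < a) :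
    (∫ y : ℝ, |(Complex.digamma (((((1 / 2 : ℝ)) : ℂ) + y * Complex.I) / 2)).re| /
        (a ^ 2 + (0 - y) ^ 2)) ≤
      π / a * (Real.log 3 + 12) + (4 / a ^ 2 + 8) := by
  simpa using J_le ha 0

/-- **For `t ≥ 3`**: `J(a, t) ≤ (π/a) log t + [(π/a)(12 + log 2) + 4/a² + 8]` (the hypothesis `hJ`
of `KadiriExplicit.master_explicit`, with `αJ = π/a`). [cite: Kadiri2005, (C40)] -/
theorem J_le_log {a : ℝ} (ha : 0 < a) {t : ℝ} (ht : 3 ≤ t) :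
    (∫ y : ℝ, |(Complex.digamma (((((1 / 2 : ℝ)) : ℂ) + y * Complex.I) / 2)).re| /
        (a ^ 2 + (t - y) ^ 2)) ≤
      π / a * Real.log t + (π / a * (12 + Real.log 2) + (4 / a ^ 2 + 8)) := by
  have h := J_le ha t
  rw [abs_of_pos (by linarith : 0 < t)] at h
  have hlog : Real.log (3 + t) ≤ Real.log t + Real.log 2 := by
    rw [← Real.log_mul (by linarith) two_ne_zero]
    exact Real.log_le_log (by linarith) (by linarith)
  have hπa : 0 ≤ π / a := by positivity
  nlinarith [mul_le_mul_of_nonneg_left hlog hπa]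

end KadiriDigammaIntegral

end Literature.NumberTheory.LFunctions
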